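import Literature.AlgebraicGeometry.AbelianSchemes.IsogenyOfGenericIsogeny
import Literature.AlgebraicGeometry.GroupSchemes.SectionsOfFiniteOverIntegrallyClosed
import Literature.AlgebraicGeometry.GroupSchemes.GroupSchemeKernel
import Literature.AlgebraicGeometry.GroupSchemes.UnitComponentOfFiniteGroupScheme
import Literature.AlgebraicGeometry.GroupSchemes.UnitComponentReductionSequence
import HarnessLib

/-!
# Reduction on the kernel of a generic isogeny over a henselian Dedekind domain: `(Ker φ)(K) = (Ker φ)(R)`, and the kernel of
# `(Ker φ)(R) → (Ker φ)(κ)` is the unit component `(Ker φ)⁰(R)` ([SerreTate1968] §1 Lemma 1; [Tate1997FiniteFlatGroupSchemes] (3.7);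
# [BoschLutkebohmertRaynaud1990] §7.3 Prop. 6 (p. 180))

Topic `Literature/AlgebraicGeometry/AbelianSchemes`, namespace `Literature.AlgebraicGeometry.AbelianSchemes.AbelianSchemeOver`.  THEOREMS ONLY (no
definition, no named fact, no instance, no notation, no `sorry`).  DICT organ **(o-c2l)** of the P6c desk (F0P6c-plan (g0), 2026-09-01; cell
`pub/hodgecm-mathlib`, P6 «MOD», door P″): the ★ (b1-iii) package `GroupSchemes/UnitComponentReductionSequence` APPLIED to the kernel group scheme
`G := Ker φ` (★ `GroupSchemeKernel.ker φ = A ×_{φ, B, e} 𝟙`, a group object of `Over (Spec R)` with the closed homomorphic immersion `kerι φ`) of a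
homomorphism `φ : A → B` of abelian schemes over a Dedekind domain `R` (fraction field `K`) whose generic fibre is an isogeny (★ (o-c2f)
`AbelianSchemes/IsogenyOfGenericIsogeny`: then `Ker φ → Spec R` is finite flat).  The letters DICT (c2) `red_translΩ` and (b4′) `canonicalLine` consume:
* §1 `isFinite_ker_hom`, `flat_ker_hom` — `Ker φ → Spec R` is finite and flat (★ (o-c2f) along ★ `isPullback_kerι_left`);
* §2 **`existsUnique_section_ker_comp_eq`** — `(Ker φ)(K) = (Ker φ)(R)`: every `K`-point of `Ker φ` over `Spec R` is a unique section (★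
  `existsUnique_section_comp_eq_of_isIntegrallyClosed`: `R` is integrally closed and `Ker φ` is finite);
* §3 **`exists_unitComponent_ker_reduction`** — over a HENSELIAN `R` (the DVR `𝒪_L` of record), `Ker φ` has a unit component `j : G₀ ↪ Ker φ`
  (homomorphism, open and closed immersion, connected source: ★ `exists_unitComponent`, [Tate1997FiniteFlatGroupSchemes] (3.7) (I)) and a section
  `s ∈ (Ker φ)(R)` factors through `G₀` iff its reduction `Spec κ → Spec R → Ker φ` is the unit (★ `exists_section_factor_iff_reduction_eq_unit`) —
  «`L₀ := ker ((Ker φ)(R) → (Ker φ)(κ)) = (Ker φ)⁰(R)`».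
SURJECTIVITY of the reduction when all `deg φ_K` points are `K`-rational is ★ `ReductionSurjectiveOfCardSections.exists_section_comp_eq_of_card_sections_eq_finrank`
BY NAME on `G := Ker φ` (rank `= kerRank φ_K` by ★ (o-c2f′) `IsogenyOfGenericIsogenyRank`); not restated.  Generic capital `--supports stmt-HodgeConjecture-24832`.
HONEST LABEL: HC_CM is proved only modulo the cell's 2 remaining named inputs (hLiu418 24832, h413 24833) until rung 0 closes; this file pays no letter.

## References
* [SerreTate1968] J.-P. Serre, J. Tate, *Good reduction of abelian varieties*, Ann. of Math. 88 (1968), §1 Lemma 1.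
* [Tate1997FiniteFlatGroupSchemes] J. Tate, *Finite flat group schemes* (1997), (3.7) (connected–étale sequence over a henselian local base).
* [BoschLutkebohmertRaynaud1990] S. Bosch, W. Lütkebohmert, M. Raynaud, *Néron Models* (1990), §7.3 Prop. 6 (p. 180).
* [GortzWedhorn2020] U. Görtz, T. Wedhorn, *Algebraic Geometry I*, 2nd ed. (2020), Definition 4.45 (2) (kernel of a homomorphism of group schemes).
-/

set_option autoImplicit false

noncomputable section

universe u

open CategoryTheory CategoryTheory.Limits AlgebraicGeometry IsLocalRing MonoidalCategory CartesianMonoidalCategory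
open scoped MonObj
open Literature.NumberTheory.EllipticCurves (specGenericPoint)
open Literature.AlgebraicGeometry.Motives (AbelianVariety)
open Literature.AlgebraicGeometry.GroupSchemes

namespace Literature.AlgebraicGeometry.AbelianSchemes

namespace AbelianSchemeOver

variable {R : Type u} [CommRing R] [IsDedekindDomain R] (K : Type u) [Field K] [Algebra R K] [IsFractionRing R K]
  {A B : AbelianSchemeOver (Spec (CommRingCat.of R))} (φ : A.X ⟶ B.X) [IsMonHom φ]

/-! ### §1 `Ker φ → Spec R` is finite and flat -/

omit [IsDedekindDomain R] [IsMonHom φ] in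
/-- The structure morphism of `Ker φ = A ×_{φ,B,e} 𝟙` is the second projection (on underlying schemes). [cite: GortzWedhorn2020, Definition 4.45 (2)] -/
theorem ker_hom_eq : (GroupSchemeKernel.ker φ).hom = (pullback.snd φ (η[B.X] : 𝟙_ _ ⟶ B.X)).left := by
  have h := Over.w (pullback.snd φ (η[B.X] : 𝟙_ _ ⟶ B.X))
  exact h.symm.trans (Category.comp_id _)

/-- **`Ker φ → Spec R` is FINITE** for a generic isogeny `φ` (base change of the finite `φ`, ★ `isFinite_left_of_isIsogeny_genericFibre`, along the unit
section, ★ `GroupSchemeKernel.isPullback_kerι_left`). [cite: BoschLutkebohmertRaynaud1990, §7.3 Prop. 6 (p. 180)] -/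
theorem isFinite_ker_hom (hφ : AbelianVariety.IsIsogeny (fibreHom φ (specGenericPoint R K))) : IsFinite (GroupSchemeKernel.ker φ).hom := by
  haveI := isFinite_left_of_isIsogeny_genericFibre K φ hφ
  rw [ker_hom_eq]
  exact MorphismProperty.of_isPullback (GroupSchemeKernel.isPullback_kerι_left φ) inferInstance

/-- **`Ker φ → Spec R` is FLAT** for a generic isogeny `φ`. [cite: BoschLutkebohmertRaynaud1990, §7.3 Prop. 6 (p. 180)] -/
theorem flat_ker_hom (hφ : AbelianVariety.IsIsogeny (fibreHom φ (specGenericPoint R K))) : Flat (GroupSchemeKernel.ker φ).hom := by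
  have hiso : ∀ ⦃Ω : Type u⦄ [Field Ω] [IsAlgClosed Ω] (t : Spec (.of Ω) ⟶ Spec (.of R)), AbelianVariety.IsIsogeny (fibreHom φ t) :=
    fun _ _ _ t => isIsogeny_fibreHom_of_isIsogeny_genericFibre K φ hφ t
  haveI := flat_left_of_isIsogeny_fibreHom φ hiso
  rw [ker_hom_eq]
  exact MorphismProperty.of_isPullback (GroupSchemeKernel.isPullback_kerι_left φ) inferInstance

/-! ### §2 `(Ker φ)(K) = (Ker φ)(R)` -/

/-- **`(Ker φ)(K) = (Ker φ)(R)`**: every `K`-point `t : Spec K → Ker φ` over `Spec R` is `Spec K → Spec R → Ker φ` for a UNIQUE section `s` (the Dedekind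
domain `R` is integrally closed and `Ker φ` is finite over it). [cite: SerreTate1968, §1 Lemma 1] [cite: BoschLutkebohmertRaynaud1990, §7.3 Prop. 6 (p. 180)] -/
theorem existsUnique_section_ker_comp_eq (hφ : AbelianVariety.IsIsogeny (fibreHom φ (specGenericPoint R K)))
    (t : Spec (CommRingCat.of K) ⟶ (GroupSchemeKernel.ker φ).left)
    (ht : t ≫ (GroupSchemeKernel.ker φ).hom = Spec.map (CommRingCat.ofHom (algebraMap R K))) :
    ∃! s : 𝟙_ (Over (Spec (CommRingCat.of R))) ⟶ GroupSchemeKernel.ker φ,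
      Spec.map (CommRingCat.ofHom (algebraMap R K)) ≫ s.left = t := by
  haveI := isFinite_ker_hom K φ hφ
  exact UnitComponent.existsUnique_section_comp_eq_of_isIntegrallyClosed R K (GroupSchemeKernel.ker φ) t ht

/-! ### §3 The unit component of `Ker φ` and the kernel of reduction on its sections (henselian base) -/

/-- **The kernel of reduction on `(Ker φ)(R)` is the unit component `(Ker φ)⁰(R)`** — `R` a HENSELIAN Dedekind domain (e.g. the complete DVR
`𝒪_L`), `φ` a generic isogeny: `Ker φ` (finite over `R`) has a unit component `j : G₀ ↪ Ker φ` — a homomorphism of group objects which is an open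
and closed immersion with connected source ([Tate1997FiniteFlatGroupSchemes] (3.7) (I), ★ `exists_unitComponent`) — and a section `s` of `Ker φ`
factors through `G₀` iff its reduction `Spec κ(R) → Spec R → Ker φ` is the unit `κ(R)`-point (★ `exists_section_factor_iff_reduction_eq_unit`).
[cite: Tate1997FiniteFlatGroupSchemes, (3.7)] [cite: SerreTate1968, §1 Lemma 1] -/
theorem exists_unitComponent_ker_reduction [HenselianLocalRing R] (hφ : AbelianVariety.IsIsogeny (fibreHom φ (specGenericPoint R K))) :
    ∃ (G₀ : Over (Spec (CommRingCat.of R))) (_ : GrpObj G₀) (j : G₀ ⟶ GroupSchemeKernel.ker φ),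
      (IsMonHom j ∧ IsOpenImmersion j.left ∧ IsClosedImmersion j.left ∧ ConnectedSpace ↥G₀.left) ∧
        ∀ s : 𝟙_ (Over (Spec (CommRingCat.of R))) ⟶ GroupSchemeKernel.ker φ,
          (∃ s₀ : 𝟙_ (Over (Spec (CommRingCat.of R))) ⟶ G₀, s₀ ≫ j = s) ↔
            Spec.map (CommRingCat.ofHom (residue R)) ≫ s.left =
              Spec.map (CommRingCat.ofHom (residue R)) ≫ (η[GroupSchemeKernel.ker φ] : 𝟙_ _ ⟶ _).left := by
  haveI := isFinite_ker_hom K φ hφ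
  obtain ⟨G₀, inst, j, h1, h2, h3, h4⟩ := exists_unitComponent R (GroupSchemeKernel.ker φ)
  refine ⟨G₀, inst, j, ⟨h1, h2, h3, h4⟩, fun s => ?_⟩
  haveI := h1; haveI := h2; haveI := h3; haveI := h4
  exact UnitComponent.exists_section_factor_iff_reduction_eq_unit R (GroupSchemeKernel.ker φ) G₀ j s

end AbelianSchemeOver

end Literature.AlgebraicGeometry.AbelianSchemes

end
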